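import Literature.AnabelianGeometry.SemiGraphs.TemperedAnabelian
import Mathlib.Topology.Algebra.Group.Quotient
import HarnessLib

/-!
# Profinite completions (L3 interface `IsProfiniteCompletion`): the finite extension property

Mochizuki, *Semi-graphs of anabelioids*, Publ. RIMS **42** (2006) [SemiAnbd], §6 p. 69 ("we shall denote
the profinite completion of a group by means of a `∧`"; "`Π_{X_K} := (Π^temp_{X_K})^∧`") and [EtTh] §1
p. 12 [cite: MochizukiEtTh2009, §1 p.12]. Layer L2 of the abc-iut cell, seat abc-iut-L2-t1 (root owner);
PROOF-ONLY infrastructure for the FINER model of the L2 root (`Π^tp_X := (F̂₂ ×_Ẑ ℤ) × G_{ℚ_p}`, in which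
the tempered factor is abc-iut-w5-d218's fibre product `TemperedFibreProduct*` rather than the discrete
`F₂` of `SettingModelCurve.lean`), generalising `SettingModelFreeGroup.isProfiniteCompletion_prodMap_etaCont`
from Mathlib's completion of DISCRETE groups to arbitrary maps satisfying the tree's predicate
`SemiGraphs.IsProfiniteCompletion ι`:
* `IsProfiniteCompletion.exists_extend` — every CONTINUOUS homomorphism `G → Q` to a finite discrete
  group extends along `ι : G → Ĝ` to a continuous homomorphism `Ĝ → Q` (via `G/Ker ≅ Ĝ/V` for the open
  normal `V` with `Ker = ι⁻¹ V`, surjectivity by density);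
(Products of profinite completions are already in the tree: abc-iut-w5-d218's
`SemiGraphs.IsProfiniteCompletion.prodMap`, `ProfiniteCompletionEta.lean`.)
Classical; no definitions, no instances, no named facts; nothing of [SemiAnbd]/[EtTh] asserted; no side
taken on [IUTchIII] Cor. 3.12.
-/

noncomputable section

namespace Literature.AnabelianGeometry.SemiGraphs

namespace IsProfiniteCompletion

open Topology

variable {G Ĝ : Type*} [Group G] [TopologicalSpace G] [IsTopologicalGroup G]
  [Group Ĝ] [TopologicalSpace Ĝ] [IsTopologicalGroup Ĝ] {ι : G →ₜ* Ĝ}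

omit [IsTopologicalGroup G] in
/-- **Finite extension property of a profinite completion**: a continuous homomorphism from `G` to a
finite discrete group `Q` extends (through `ι`) to a continuous homomorphism on `Ĝ` ([SemiAnbd] §6 p. 69:
finite quotients of `Π^temp` are quotients of `Π = (Π^temp)^∧`). [cite: MochizukiSemiAnbd2006, §6 p.69] -/
theorem exists_extend (h : IsProfiniteCompletion ι) {Q : Type*} [Group Q] [TopologicalSpace Q]
    [DiscreteTopology Q] [Finite Q] (f : G →ₜ* Q) : ∃ F : Ĝ →ₜ* Q, ∀ g, F (ι g) = f g := by
  classical
  -- the kernel of `f` as an open normal subgroup of finite index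
  have hKopen : IsOpen ((f.toMonoidHom.ker : Subgroup G) : Set G) := by
    have : ((f.toMonoidHom.ker : Subgroup G) : Set G) = f ⁻¹' {1} := by
      ext x; simp [MonoidHom.mem_ker]
    rw [this]
    exact (isOpen_discrete _).preimage f.continuous
  let U : OpenNormalSubgroup G := { toSubgroup := f.toMonoidHom.ker, isOpen' := hKopen }
  have hUfi : U.toSubgroup.FiniteIndex := by
    haveI : Finite (G ⧸ f.toMonoidHom.ker) :=
      Finite.of_injective _ (QuotientGroup.kerLift_injective f.toMonoidHom)
    exact Subgroup.finiteIndex_of_finite_quotient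
  obtain ⟨V, hV⟩ := h.comap_surjective U hUfi
  haveI : V.toSubgroup.Normal := V.isNormal'
  have hle : f.toMonoidHom.ker ≤ V.toSubgroup.comap ι.toMonoidHom := hV.le
  -- `θ : G/Ker f → Ĝ/V`, bijective
  let θ : G ⧸ f.toMonoidHom.ker →* Ĝ ⧸ V.toSubgroup :=
    QuotientGroup.map _ _ ι.toMonoidHom hle
  have hθinj : Function.Injective θ := by
    rw [injective_iff_map_eq_one]
    intro x hx
    obtain ⟨g, rfl⟩ := QuotientGroup.mk_surjective x
    rw [QuotientGroup.map_mk, QuotientGroup.eq_one_iff] at hx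
    rw [QuotientGroup.eq_one_iff]
    have : g ∈ V.toSubgroup.comap ι.toMonoidHom := hx
    rwa [← hV] at this
  have hθsurj : Function.Surjective θ := by
    intro y
    obtain ⟨x, rfl⟩ := QuotientGroup.mk_surjective y
    -- the open coset `x • V` meets the dense range of `ι`
    have hopen : IsOpen ((fun z : Ĝ => x⁻¹ * z) ⁻¹' (V : Set Ĝ)) :=
      V.isOpen'.preimage (continuous_const.mul continuous_id)
    obtain ⟨g, hg⟩ := h.denseRange.exists_mem_open hopen ⟨x, by simp⟩
    refine ⟨QuotientGroup.mk g, ?_⟩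
    rw [QuotientGroup.map_mk]
    exact (QuotientGroup.eq.mpr hg).symm
  let θe : G ⧸ f.toMonoidHom.ker ≃* Ĝ ⧸ V.toSubgroup := MulEquiv.ofBijective θ ⟨hθinj, hθsurj⟩
  -- the extension
  haveI : DiscreteTopology (Ĝ ⧸ V.toSubgroup) := QuotientGroup.discreteTopology V.isOpen'
  let F : Ĝ →* Q :=
    ((QuotientGroup.kerLift f.toMonoidHom).comp θe.symm.toMonoidHom).comp
      (QuotientGroup.mk' V.toSubgroup)
  have hFc : Continuous F := by
    apply Continuous.comp (g := fun y : Ĝ ⧸ V.toSubgroup =>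
      (QuotientGroup.kerLift f.toMonoidHom) (θe.symm.toMonoidHom y)) continuous_of_discreteTopology
    exact QuotientGroup.continuous_mk (N := V.toSubgroup)
  refine ⟨⟨F, hFc⟩, fun g => ?_⟩
  show (QuotientGroup.kerLift f.toMonoidHom) (θe.symm (QuotientGroup.mk (ι g))) = f g
  have hθg : θe (QuotientGroup.mk g) = QuotientGroup.mk (ι g) := by
    show θ (QuotientGroup.mk g) = _
    rw [QuotientGroup.map_mk]
    rfl
  rw [← hθg, MulEquiv.symm_apply_apply]
  rfl

end IsProfiniteCompletion

end Literature.AnabelianGeometry.SemiGraphs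

end
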